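/-
Origin: HOME/pub-hodgecm-prl1/lean/Prl1/SignPattern.lean — session planner-pub-hodgecm-prl1-0 (unit pub-hodgecm-prl1,
expansion prover a-1).  Intended final place: `HodgeCM/Proofs/SignPattern.lean` (imports only `HodgeCM.Proofs.Landherr`).
Origin: expansion seat `planner-pub-hodgecm-prl1-0` (unit pub-hodgecm-prl1), handover v1 2026-08-18T03:12:21Z (`HOME/pub-hodgecm-prl1/lean/Prl1/SignPattern.lean`, md5 610ae885);
landed by the gen-5 packager as `HodgeCM/Proofs/SignPattern.lean` (module renamed `Prl1.SignPattern` → `HodgeCM.Proofs.SignPattern`, `import Prl1.*` lines renamed accordingly; body otherwise verbatim).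
-/
import Summits.HodgeConjecture.HodgeCM.Proofs.Landherr

set_option autoImplicit false

/-!
# Totally real elements of a CM field with prescribed signs

For Def 3.2 of PerL v5 (tex ll. 269–279, 299–304: the hermitian lines `W_i = (L, a_i x ȳ)` are taken "with the
forced signs" of Lemma 3.3(a)) one needs, for an arbitrary sign prescription at the real places of `L₀`
(= infinite places of the CM field `L`), an element `a ∈ L⁺` (fixed by complex conjugation) with `τ a ∈ ℝ^×` of the
prescribed sign at every complex embedding `τ`.  This is weak approximation at the infinite places; we prove it
from `HodgeCM.exists_neg_at_pos_off` (Dirichlet's unit theorem, already in the package) by multiplying, over the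
places where the prescription is "negative", elements negative at exactly that place.

Main result: `HodgeCM.exists_isReal_signs`.
-/

noncomputable section

open NumberField NumberField.InfinitePlace

namespace HodgeCM

open Literature.AlgebraicGeometry.ShimuraVarieties (conjRingHomK embedding_conjRingHomK)

/-- A conjugation-fixed element of `L` takes the same (real) value at conjugate complex embeddings. -/
theorem conjugate_apply_of_isReal (L : CMField) {a : L} (ha : conjRingHomK L a = a) (τ : L →+* ℂ) :
    ComplexEmbedding.conjugate τ a = τ a := by
  rw [ComplexEmbedding.conjugate_coe_eq, ← embedding_conjRingHomK, ha]

/-- One place: an element of `L⁺`, real and nonzero at every complex embedding, NEGATIVE exactly at the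
embeddings over the infinite place `w`. -/
theorem exists_neg_exactly_at (L : CMField) (w : InfinitePlace L) :
    ∃ b : L, conjRingHomK L b = b ∧
      ∀ τ : L →+* ℂ, ∃ r : ℝ, τ b = r ∧ r ≠ 0 ∧ (r < 0 ↔ InfinitePlace.mk τ = w) := by
  obtain ⟨b, hb, ⟨r₀, hr₀, hr₀neg⟩, hpos⟩ := exists_neg_at_pos_off L w.embedding
  refine ⟨b, hb, fun τ => ?_⟩
  by_cases hτ : InfinitePlace.mk τ = w
  · have hτ' : InfinitePlace.mk τ = InfinitePlace.mk w.embedding := by rw [mk_embedding]; exact hτ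
    rcases mk_eq_iff.mp hτ' with h | h
    · exact ⟨r₀, by rw [h]; exact hr₀, hr₀neg.ne, ⟨fun _ => hτ, fun _ => hr₀neg⟩⟩
    · refine ⟨r₀, ?_, hr₀neg.ne, ⟨fun _ => hτ, fun _ => hr₀neg⟩⟩
      rw [← conjugate_apply_of_isReal L hb τ, h, hr₀]
  · obtain ⟨s, hs, hspos⟩ := hpos τ (by rwa [mk_embedding])
    exact ⟨s, hs, hspos.ne', ⟨fun h => absurd hspos (not_lt.mpr h.le), fun h => absurd h hτ⟩⟩

/-- **Prescribed signs at the real places** (weak approximation at infinity for `L₀ ⊂ L`): for every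
`P : InfinitePlace L → Bool` there is `a ∈ L⁺` with `τ a` real, nonzero, and positive iff `P (mk τ)`. -/
theorem exists_isReal_signs (L : CMField) (P : InfinitePlace L → Bool) :
    ∃ a : L, conjRingHomK L a = a ∧
      ∀ τ : L →+* ℂ, ∃ r : ℝ, τ a = r ∧ r ≠ 0 ∧ (0 < r ↔ P (InfinitePlace.mk τ) = true) := by
  classical
  suffices h : ∀ N : Finset (InfinitePlace L), ∃ a : L, conjRingHomK L a = a ∧
      ∀ τ : L →+* ℂ, ∃ r : ℝ, τ a = r ∧ r ≠ 0 ∧ (r < 0 ↔ InfinitePlace.mk τ ∈ N) by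
    obtain ⟨a, ha, h⟩ := h (Finset.univ.filter fun w => P w = false)
    refine ⟨a, ha, fun τ => ?_⟩
    obtain ⟨r, hr, hr0, hiff⟩ := h τ
    refine ⟨r, hr, hr0, ?_⟩
    simp only [Finset.mem_filter, Finset.mem_univ, true_and] at hiff
    constructor
    · intro hpos
      by_contra hP
      have hneg := hiff.mpr (by simpa using hP)
      exact absurd hpos (not_lt.mpr hneg.le)
    · intro hP
      rcases lt_trichotomy r 0 with hlt | heq | hgt
      · have := hiff.mp hlt; rw [hP] at this; exact absurd this (by decide)
      · exact absurd heq hr0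
      · exact hgt
  intro N
  induction N using Finset.induction_on with
  | empty => exact ⟨1, by simp, fun τ => ⟨1, by simp, one_ne_zero, by simp⟩⟩
  | @insert w N hw ih =>
    obtain ⟨a, ha, hA⟩ := ih
    obtain ⟨b, hb, hB⟩ := exists_neg_exactly_at L w
    refine ⟨b * a, by rw [map_mul, ha, hb], fun τ => ?_⟩
    obtain ⟨r, hr, hr0, hriff⟩ := hA τ
    obtain ⟨s, hs, hs0, hsiff⟩ := hB τ
    refine ⟨s * r, by rw [map_mul, hr, hs]; push_cast; ring, mul_ne_zero hs0 hr0, ?_⟩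
    rw [Finset.mem_insert]
    rcases lt_or_gt_of_ne hs0 with hsn | hsp <;> rcases lt_or_gt_of_ne hr0 with hrn | hrp
    · exact absurd ((hsiff.mp hsn) ▸ hriff.mp hrn) hw
    · exact ⟨fun _ => Or.inl (hsiff.mp hsn), fun _ => mul_neg_of_neg_of_pos hsn hrp⟩
    · exact ⟨fun _ => Or.inr (hriff.mp hrn), fun _ => mul_neg_of_pos_of_neg hsp hrn⟩
    · constructor
      · intro h; exact absurd h (not_lt.mpr (mul_pos hsp hrp).le)
      · rintro (h | h)
        · exact absurd (hsiff.mpr h) (not_lt.mpr hsp.le)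
        · exact absurd (hriff.mpr h) (not_lt.mpr hrp.le)

end HodgeCM

end
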